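import Summits.QuantumFields.YangMills.Theorems.FluctuationComparisonRegPrIntLS2BetaFlatTubeGrowthOfIsolated
import Summits.QuantumFields.YangMills.Theorems.FluctuationComparisonRegPrIntLIsolOfOrbBar
import Summits.QuantumFields.YangMills.Theorems.FluctuationComparisonRegPrIntLSupTailDepthInduction
import Literature.MathematicalPhysics.QuantumFieldTheory.Balaban1983to89.T3MinimiserStabilityReduction
import HarnessLib

/-!
# S2β · THE FLAT INHABITANT OF THE (T)-CHAIN — brick 5: GAP♭(1,1) ⟸ ISOL∘(δ)(1,1) with HESS∘ discharged, and under Prop. 7 the flat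
# datum's ISOL∘ letter is free: TUBE♭(1,1) ∕ GAP♭(1,1) ⟸ {CL(1), Prop7AtMostOneCriticalOrbitAt}

Cell `ym3-torus` (YM ladder rung R3 = continuum `SU(2)` Yang–Mills on the three-torus at fixed lattice data — a RUNG: NOT d = 4, NOT infinite volume,
NOT a mass gap, NOT Clay).  Width seat `ym3-torus-px16` (gen 17), brick 5 of the «FLAT INHABITANT of the (T)-chain» pen (★★OWNER g40 №238).  Crux
`stmt-QuantumFields-20520` (`…Theses.UnitScaleTilt.FluctuationComparisonRegPrIntL`), LINE S2β; `--kind proof --supports stmt-QuantumFields-20520 --as helper`: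
count-neutral, DEFINITION-FREE (0 `def`, 0 `instance`, 0 `notation`, 0 `sorry`, default heartbeats).

WHY.  ✓brick 4 `…S2BetaFlatTubeGrowthOfIsolated` read (T3)'s TUBE♭ ∃-theorem at the flat datum with HESS∘ discharged.  (T3) also has the GAP♭ edition
(✓`exists_chart_gapFlat_of_hessian_pos_of_isolated`, RECORD 17fo: GAP♭(V,U₀) ⟸ {HESS∘, ISOL∘(δ)} for `γ ≤ γ₁(δ)`), and px17's flat-datum doors
(✓`…IsolOfOrbBar.isol_of_orbBar`, ✓`…OrbBarOfRegArgminBar.orbBar_one_of_prop7At`) make ISOL∘(δ)(1,1) FREE under print's Prop. 7 (at most one critical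
orbit) and the closure letter CL(1).  THIS FILE: §0 the flat configuration IS a good history (`θBal > 0`); §1 GAP♭(1,1) ⟸ ISOL∘(δ)(1,1) (HESS∘ by ✓brick 4 `hessPos_flat_of_tube_rows`);
§2 TUBE♭(1,1) and GAP♭(1,1) ⟸ {CL(1), `Prop7AtMostOneCriticalOrbitAt L a₀ B₃`} — so in px17's ✓`gapFlatAt_one_of_pos_of_prop7At_of_closePair` the POS∘(1)
letter is no longer a letter.

WHAT.
* §1 ★★★★`exists_gapFlat_flat_of_isolated (L b₀ p₀) (hb hp) (δ) (hδ)`: (T3)'s GAP♭ ∃-theorem at `V := 1`, `U₀ := 1` (same `γ₁ = min (min γ₁ᴸ γ₁ᴿ) γ₁^{CP}(δ)`),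
  HESS∘ discharged and «`1` is a good history» discharged (§0, `γ ≤ 1`); the one remaining row is ISOL∘(δ)(1,1).
* §2 ★★★★`exists_tubeGrowth_flat_of_prop7At`, ★★★★`exists_gapFlat_flat_of_prop7At`: `J < K`, `0 < ε₀ ≤ a₀` admissible, CL(1) =
  `closure (fibre 1 ∩ histGood) ⊆ fibre 1`, `h7 : Prop7AtMostOneCriticalOrbitAt L a₀ B₃`, `0 < B₃` ⟹ TUBE♭(1,1) (every `δ`) ∕ GAP♭(1,1) (`γ ≤ γ₁(δ)`).

HONEST.  One datum (the flat one); conditional on print's Prop. 7 in the tree's `Prop7AtMostOneCriticalOrbitAt` form (a HYPOTHESIS, not proved here), on CL(1)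
; HESS∘ at a general datum ([Balaban1985BackgroundPropagators] Thm 3.11), ISOL∘(δ) in general, TUBE-REG∘ (K-uniform μ), GAP♯∘, EXW∘, S2β
and crux 20520 are NOT proved; rung R3 = `YM3TorusSU2` as filed — SU(2) YM₃ on T³; the Yang–Mills mass gap is NOT proved.
[cite: Balaban1985Variational, Thm 1 (8)-(10) p.279, Prop. 7 and (142) p.299, (6) p.278; Balaban1985UV3, (12)-(13) p.259, (18)-(22) p.260; Balaban1987RG1, (2.10) p.267]
-/

set_option autoImplicit false

noncomputable section

open Set Filter Topology Function
open scoped Matrix.Norms.L2Operator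
open Literature.MathematicalPhysics.QuantumFieldTheory.Balaban1983to89
open Literature.MathematicalPhysics.QuantumFieldTheory.Balaban1983to89.T3ContinuumYM3Torus
open Literature.MathematicalPhysics.QuantumFieldTheory.Balaban1983to89.T3UnitLawDensityEML (ℰp)
open Literature.MathematicalPhysics.QuantumFieldTheory.Balaban1983to89.T3UnitScaleTilt
open Literature.MathematicalPhysics.QuantumFieldTheory.Balaban1983to89.T3TiltDescent
open Literature.MathematicalPhysics.QuantumFieldTheory.Balaban1983to89.T3ConstrainedMinimiser (fibre)
open Literature.MathematicalPhysics.QuantumFieldTheory.Balaban1983to89.T3PrintedRegularMinimiser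
open Literature.MathematicalPhysics.QuantumFieldTheory.Balaban1983to89.T3Thm1UniquenessSchema (Prop7AtMostOneCriticalOrbitAt)
open Literature.MathematicalPhysics.QuantumFieldTheory.Balaban1983to89.T4Continuum
open Literature.MathematicalPhysics.QuantumFieldTheory.Balaban1983to89.ExpMeanLog (deltaSU expMeanLogSU)
open Literature.MathematicalPhysics.QuantumFieldTheory.Balaban1983to89.BlockAveraging (Idx)
open Literature.MathematicalPhysics.QuantumFieldTheory.Balaban1983to89.HaarExponentialChart
open Literature.MathematicalPhysics.QuantumFieldTheory.Balaban1983to89.LogChartProduct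
open scoped Literature.MathematicalPhysics.QuantumFieldTheory.Balaban1983to89.T3OrbitAverage
open Literature.MathematicalPhysics.QuantumFieldTheory.Balaban1983to89.Node00 (coeField)
open Summit.QuantumFields.YangMills.Theorems.FluctuationComparisonRegPrIntLWregChain (iterCentralBond)
open Summit.QuantumFields.YangMills.Theorems.FluctuationComparisonRegPrIntLWregGlue (WindowChart)
open Summit.QuantumFields.YangMills.Theorems.FluctuationComparisonRegPrIntLS2BetaResidualSubgroup
open Summit.QuantumFields.YangMills.Theorems.FluctuationComparisonRegPrIntLS2BetaTubeGrowthOfHessianPosDock (posCollar_of_hessian_pos_of_clauses)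
open Summit.QuantumFields.YangMills.Theorems.FluctuationComparisonRegPrIntLS2BetaTubeGrowthOfIsolated (gapFlatAt_of_pos_of_isolated_of_closePair)
open Summit.QuantumFields.YangMills.Theorems.FluctuationComparisonRegPrIntLS2BetaCoeFieldSmoothWindowChart (contDiffAt_coeField_windowChart_of_histGood)
open Summit.QuantumFields.YangMills.Theorems.FluctuationComparisonRegPrIntLS2BetaChartContLaplaceRows (exists_laplaceRows)
open Summit.QuantumFields.YangMills.Theorems.FluctuationComparisonRegPrIntLS2BetaTubularChartDockLocal (exists_tubularHaarChart_pivotAct_local)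
open Summit.QuantumFields.YangMills.Theorems.FluctuationComparisonRegPrIntLS2BetaPeanoSmooth (exists_gamma_chainRegime)
open Summit.QuantumFields.YangMills.Theorems.FluctuationComparisonRegPrIntLS2BetaFlatTubeGrowthOfIsolated (hessPos_flat_of_tube_rows exists_tubeGrowth_flat_of_isolated)
open Summit.QuantumFields.YangMills.Theorems.FluctuationComparisonRegPrIntLS2BetaResidualGaugeCentral (descendTo_one_eml)
open Summit.QuantumFields.YangMills.Theorems.FluctuationComparisonRegPrIntLIsolOfOrbBar (isol_of_orbBar)
open Summit.QuantumFields.YangMills.Theorems.FluctuationComparisonRegPrIntLOrbBarOfRegArgminBar (orbBar_one_of_prop7At)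
open Summit.QuantumFields.YangMills.Theorems.FluctuationComparisonRegPrIntLSupTailDepthInduction (mem_histGood_iff_descendTo)
open Literature.MathematicalPhysics.QuantumFieldTheory.Balaban1983to89.T3MinimiserStabilityReduction (θBal_pos)

namespace Summit.QuantumFields.YangMills.Theorems.FluctuationComparisonRegPrIntLS2BetaFlatGapOfIsolated

/-! ## §0 The flat configuration is a good history -/

/-- **`1 ∈ histGood` for positive windows**: every level of the flat run is flat (lit ✓`descendTo_one`) and `PlaqSmall θ 1` for `θ > 0` (lit ✓`plaqSmall_one`).
[cite: Balaban1985UV3, (7) p.257; Balaban1987RG1, (0.11) p.253] -/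
theorem one_mem_histGood_of_pos (F : T3Family) {θ : ℕ → ℝ} (hθ : ∀ i, 0 < θ i) (K n : ℕ) :
    (1 : GaugeField (F.P K) 0 (Matrix.specialUnitaryGroup (Fin 2) ℂ)) ∈ histGood F ℰp θ K n := by
  rw [mem_histGood_iff_descendTo]
  intro j _ hjK
  rw [T3DescentFibreTower.descendTo_one F ℰp (fun n => T3DescentFibreTower.expMeanLogSU_E_one n) hjK]
  exact T3DescentFibreTower.plaqSmall_one (hθ j)

/-- `1 ∈ histGood F 𝓔 θBal K n` for `0 < γ ≤ 1`, `0 < b₀` (lit ✓`θBal_pos`). [cite: Balaban1985UV3, (7) p.257] -/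
theorem one_mem_histGood_θBal (F : T3Family) {γ b₀ : ℝ} (hγ : 0 < γ) (hγ1 : γ ≤ 1) (hb : 0 < b₀) (p₀ : ℝ) (K n : ℕ) :
    (1 : GaugeField (F.P K) 0 (Matrix.specialUnitaryGroup (Fin 2) ℂ)) ∈ histGood F ℰp (θBal F.L γ b₀ p₀) K n :=
  one_mem_histGood_of_pos F (fun i => θBal_pos F.hL.2.le hγ hγ1 hb p₀ i) K n

/-! ## §1 GAP♭(1,1) ⟸ ISOL∘(δ)(1,1), HESS∘ discharged -/

/-- ★★★★ **GAP♭ AT THE FLAT DATUM WITH HESS∘ DISCHARGED** — ✓(T3) `exists_chart_gapFlat_of_hessian_pos_of_isolated` read at `(V ≡ 1, U₀ ≡ 1)`: for every tube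
radius `δ > 0`, `∃ γ₁ > 0`, for every member `γ ≤ γ₁`, depth `J ≤ K`, admissible `ε₀`: ISOL∘(δ)(1,1) ⟹ GAP♭(1,1)
(`∃ μ > 0`, `μ·L^(−2(K−J))·D U ≤ A U − min` for EVERY good history `U` of the flat fibre).  HESS∘ by ✓brick 4 `hessPos_flat_of_tube_rows`; the rest as in (T3).
[cite: Balaban1985Variational, Thm 1 (8)-(10) p.279, (142) p.299; Balaban1985UV3, (12)-(13) p.259, (18)-(22) p.260; Balaban1987RG1, (2.10) p.267] -/
theorem exists_gapFlat_flat_of_isolated (L : ℕ) (b₀ p₀ : ℝ) (hb : 0 < b₀) (hp : 0 < p₀) (δ : ℝ) (hδ : 0 < δ) :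
    ∃ γ₁ : ℝ, 0 < γ₁ ∧ ∀ (F : T3Family) (γ : ℝ), F.L = L → 0 < γ → γ ≤ γ₁ →
      ∀ (J K : ℕ) (hJK : J ≤ K) (hk : K - J ≤ (F.P K).m + (F.P K).K)
        (ε₀ : ℝ), 0 < ε₀ → (143 * ((((3 + 4 : ℕ) : ℝ)) ^ 2 / 4) ^ 2) * (2 * ε₀) ≤ 1 / 3 →
          2 * (2 * ε₀) ≤ 2 * deltaSU (Fin 2) / (((3 + 4) * F.L : ℕ) : ℝ) ^ 2 →
        (∀ U ∈ closure (fibre F ℰp J K hJK (1 : GaugeField (F.P J) 0 (Matrix.specialUnitaryGroup (Fin 2) ℂ)) ∩ histGood F ℰp (θBal F.L γ b₀ p₀) K J),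
          (∃ w : Site (F.P K) 0 → Matrix.specialUnitaryGroup (Fin 2) ℂ,
          (∀ U'' : GaugeField (F.P K) 0 (Matrix.specialUnitaryGroup (Fin 2) ℂ),
          descendTo F ℰp J K hJK (GaugeField.gaugeAct w U'') = descendTo F ℰp J K hJK U'') ∧
          ∀ ℓ : PBond (F.P K) 0, dist1 (U ℓ * ((GaugeField.gaugeAct w (1 : GaugeField (F.P K) 0 (Matrix.specialUnitaryGroup (Fin 2) ℂ))) ℓ)⁻¹) ≤ δ) →
          wilsonAction4 U ≤ minActionRegPr F J K hJK ε₀ (1 : GaugeField (F.P J) 0 (Matrix.specialUnitaryGroup (Fin 2) ℂ)) →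
          (⨅ w : {w : Site (F.P K) 0 → Matrix.specialUnitaryGroup (Fin 2) ℂ |
          ∀ U : GaugeField (F.P K) 0 (Matrix.specialUnitaryGroup (Fin 2) ℂ),
          descendTo F ℰp J K hJK (GaugeField.gaugeAct w U) = descendTo F ℰp J K hJK U},
          ∑ ℓ : PBond (F.P K) 0,
          dist1 (U ℓ * ((GaugeField.gaugeAct (w : Site (F.P K) 0 → Matrix.specialUnitaryGroup (Fin 2) ℂ) (1 : GaugeField (F.P K) 0 (Matrix.specialUnitaryGroup (Fin 2) ℂ))) ℓ)⁻¹) ^ 2) = 0) →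
          ∃ μ : ℝ, 0 < μ ∧ ∀ U ∈ fibre F ℰp J K hJK (1 : GaugeField (F.P J) 0 (Matrix.specialUnitaryGroup (Fin 2) ℂ)), U ∈ histGood F ℰp (θBal F.L γ b₀ p₀) K J →
          μ * ((F.L : ℝ)⁻¹) ^ (2 * (K - J)) *
          (⨅ w : {w : Site (F.P K) 0 → Matrix.specialUnitaryGroup (Fin 2) ℂ |
          ∀ U : GaugeField (F.P K) 0 (Matrix.specialUnitaryGroup (Fin 2) ℂ),
          descendTo F ℰp J K hJK (GaugeField.gaugeAct w U) = descendTo F ℰp J K hJK U},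
          ∑ ℓ : PBond (F.P K) 0,
          dist1 (U ℓ * ((GaugeField.gaugeAct (w : Site (F.P K) 0 → Matrix.specialUnitaryGroup (Fin 2) ℂ) (1 : GaugeField (F.P K) 0 (Matrix.specialUnitaryGroup (Fin 2) ℂ))) ℓ)⁻¹) ^ 2)
          ≤ wilsonAction4 U - minActionRegPr F J K hJK ε₀ (1 : GaugeField (F.P J) 0 (Matrix.specialUnitaryGroup (Fin 2) ℂ)) := by
  classical
  obtain ⟨γ₁, hγ₁, hmain⟩ := exists_laplaceRows L b₀ p₀ hb hp
  obtain ⟨α, γ₂, hα0, hα24, hαδ, hγ₂, hreg⟩ := exists_gamma_chainRegime L b₀ p₀ hb hp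
  obtain ⟨γ₃, hγ₃, hCP⟩ := gapFlatAt_of_pos_of_isolated_of_closePair L b₀ p₀ hb hp δ hδ
  refine ⟨min (min (min γ₁ γ₂) γ₃) 1, lt_min (lt_min (lt_min hγ₁ hγ₂) hγ₃) one_pos, ?_⟩
  intro F γ hFL hγ hγle J K hJK hk ε₀ hε₀ hr3 hr2 hisol
  have hγle' : γ ≤ min (min γ₁ γ₂) γ₃ := hγle.trans (min_le_left _ _)
  have hγ1 : γ ≤ γ₁ := hγle'.trans ((min_le_left _ _).trans (min_le_left _ _))
  have hγ2 : γ ≤ γ₂ := hγle'.trans ((min_le_left _ _).trans (min_le_right _ _))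
  have hγ3 : γ ≤ γ₃ := hγle'.trans (min_le_right _ _)
  have h1h := one_mem_histGood_θBal F hγ (hγle.trans (min_le_right _ _)) hb p₀ K J
  obtain ⟨c, T, w, h137, h138, h139, -, -, -, h144, h145, -, -, h153, h154, -⟩ := hmain F γ hFL hγ hγ1 J K hJK
  obtain ⟨hαL, hθ0, hθα⟩ := hreg F γ hFL hγ hγ2 K
  obtain ⟨e, σ, eV, UZ, UV, jZ, jV, ρ, -, he1, -, hσc, hσ0, hσs, hσcomb, -, hσfree, -, -, -, -, h0Z, h0V, -, hF3, -⟩ :=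
    exists_tubularHaarChart_pivotAct_local F hJK hk _ _ rfl rfl (1 : GaugeField (F.P K) 0 (Matrix.specialUnitaryGroup (Fin 2) ℂ))
  have hU₀V : descendTo F ℰp J K hJK (1 : GaugeField (F.P K) 0 (Matrix.specialUnitaryGroup (Fin 2) ℂ)) = 1 := descendTo_one_eml F hJK
  have hU₀reg : (1 : GaugeField (F.P K) 0 (Matrix.specialUnitaryGroup (Fin 2) ℂ)) ∈ regFibrePr F J K hJK ε₀ (1 : GaugeField (F.P J) 0 (Matrix.specialUnitaryGroup (Fin 2) ℂ)) :=
        one_mem_regFibrePr_one F hε₀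
  have hmin : wilsonAction4 (1 : GaugeField (F.P K) 0 (Matrix.specialUnitaryGroup (Fin 2) ℂ)) = minActionRegPr F J K hJK ε₀ (1 : GaugeField (F.P J) 0 (Matrix.specialUnitaryGroup (Fin 2) ℂ)) := by
    rw [minActionRegPr_one F hε₀, ← T3DescentFibreTower.minAction_self F ℰp K 1]
    exact T3DescentFibreTower.minAction_one F ℰp T3DescentFibreTower.expMeanLogSU_E_one le_rfl
  have hU₀cl : (1 : GaugeField (F.P K) 0 (Matrix.specialUnitaryGroup (Fin 2) ℂ)) ∈ closure (histGood F ℰp (θBal F.L γ b₀ p₀) K J) := subset_closure h1h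
  obtain ⟨hlive, hself1⟩ := h144 1 1 hU₀V hU₀cl
  have hoffz : ∀ z, c.jac (1, z) ≠ 0 → ∀ b, (∀ c', iterCentralBond (K - J) c' ≠ b) → c.Φ (1, z) b = z b :=
    fun z hz => (h145 1 z ((h138 1 z).1 hz).1).1
  have hnhds1 : {z | c.jac (1, z) ≠ 0} ∈ 𝓝 (1 : GaugeField (F.P K) 0 (Matrix.specialUnitaryGroup (Fin 2) ℂ)) := h153 1 1 hU₀V h1h
  have hev : ∀ᶠ y in 𝓝 (0 : EuclideanSpace ℝ (Fin _)), σ y ∈ {z | c.jac (1, z) ≠ 0} :=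
    hσc.continuousAt.preimage_mem_nhds (by rw [hσ0]; exact hnhds1)
  have hoff : ∀ᶠ y in 𝓝 (0 : EuclideanSpace ℝ (Fin _)), ∀ b : PBond (F.P K) 0,
      (∀ c', iterCentralBond (P := F.P K) (K - J) c' ≠ b) → c.Φ (1, σ y) b = σ y b :=
    hev.mono fun y hy => hoffz (σ y) hy
  have hfib : ∀ᶠ y in 𝓝 (0 : EuclideanSpace ℝ (Fin _)), descendTo F ℰp J K hJK (c.Φ (1, σ y)) = 1 :=
    hev.mono fun y hy => h137 1 (σ y) hy
  have hΦ0 : c.Φ (1, σ 0) = 1 := by rw [hσ0]; exact hself1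
  have hC2 : ContDiffAt ℝ 2 (fun y => coeField (c.Φ (1, σ y))) 0 :=
    contDiffAt_coeField_windowChart_of_histGood F hJK hk hα24 hαδ hαL hθ0 hθα c 1 1 (h137 1) hoffz (h139 1).1 hlive hself1 hnhds1 hU₀V h1h
      σ hσc hσ0 hσs 2
  have hH := hessPos_flat_of_tube_rows F hJK hk (fun z => c.Φ (1, z)) 1 σ eV hσcomb hσfree rfl hΦ0 hC2 hoff hfib
  exact hCP F γ hFL hγ hγ3 J K hJK ε₀ 1 1 hU₀V h1h
    (posCollar_of_hessian_pos_of_clauses F hJK hk hα24 hαδ hαL hθ0 hθα hε₀ hr3 hr2 c T w 1 (h137 1) (h138 1) (h139 1).1 (h144 1) (h145 1) (h153 1) (h154 1)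
      1 hU₀reg h1h hmin e σ he1 hσc hσ0 hσs h0Z h0V hF3 δ hH) hisol

/-! ## §2 Under Prop. 7 (at most one critical orbit) the flat datum's ISOL∘ letter is free -/

/-- ★★★★ **TUBE♭(1,1) ⟸ {CL(1), `Prop7AtMostOneCriticalOrbitAt L a₀ B₃`}** (`J < K`, `0 < ε₀ ≤ a₀` admissible): ✓brick 4
`exists_tubeGrowth_flat_of_isolated` with «`1` is a good history» by §0 and its ISOL∘(δ)(1,1) letter discharged by ✓px17 `isol_of_orbBar` ∘ ✓`orbBar_one_of_prop7At` (REG-ARGMIN̄(1) is free: a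
closed-window achiever over the flat datum is flat, hence regular, hence on the residual orbit of `1` by Prop. 7).  CL(1) = `closure (fibre 1 ∩ histGood) ⊆ fibre 1`.
[cite: Balaban1985Variational, Prop. 7 and (142) p.299, (6) p.278; Balaban1985UV3, (18)-(22) p.260] -/
theorem exists_tubeGrowth_flat_of_prop7At {L : ℕ} {a₀ B₃ : ℝ} (h7 : Prop7AtMostOneCriticalOrbitAt L a₀ B₃) (hB₃ : 0 < B₃)
    (b₀ p₀ : ℝ) (hb : 0 < b₀) (hp : 0 < p₀) :
    ∃ γ₁ : ℝ, 0 < γ₁ ∧ ∀ (F : T3Family) (γ : ℝ), F.L = L → 0 < γ → γ ≤ γ₁ →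
      ∀ (J K : ℕ) (hlt : J < K) (hk : K - J ≤ (F.P K).m + (F.P K).K)
        (ε₀ : ℝ), 0 < ε₀ → (143 * ((((3 + 4 : ℕ) : ℝ)) ^ 2 / 4) ^ 2) * (2 * ε₀) ≤ 1 / 3 →
          2 * (2 * ε₀) ≤ 2 * deltaSU (Fin 2) / (((3 + 4) * F.L : ℕ) : ℝ) ^ 2 → ε₀ ≤ a₀ →
        closure (fibre F ℰp J K hlt.le 1 ∩ histGood F ℰp (θBal F.L γ b₀ p₀) K J) ⊆ fibre F ℰp J K hlt.le 1 →
        ∀ δ : ℝ,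
          ∃ μ : ℝ, 0 < μ ∧ ∀ U ∈ fibre F ℰp J K hlt.le (1 : GaugeField (F.P J) 0 (Matrix.specialUnitaryGroup (Fin 2) ℂ)), U ∈ histGood F ℰp (θBal F.L γ b₀ p₀) K J →
          (∃ w : Site (F.P K) 0 → Matrix.specialUnitaryGroup (Fin 2) ℂ,
          (∀ U'' : GaugeField (F.P K) 0 (Matrix.specialUnitaryGroup (Fin 2) ℂ),
          descendTo F ℰp J K hlt.le (GaugeField.gaugeAct w U'') = descendTo F ℰp J K hlt.le U'') ∧
          ∀ ℓ : PBond (F.P K) 0, dist1 (U ℓ * ((GaugeField.gaugeAct w (1 : GaugeField (F.P K) 0 (Matrix.specialUnitaryGroup (Fin 2) ℂ))) ℓ)⁻¹) ≤ δ) →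
          μ * ((F.L : ℝ)⁻¹) ^ (2 * (K - J)) *
          (⨅ w : {w : Site (F.P K) 0 → Matrix.specialUnitaryGroup (Fin 2) ℂ |
          ∀ U : GaugeField (F.P K) 0 (Matrix.specialUnitaryGroup (Fin 2) ℂ),
          descendTo F ℰp J K hlt.le (GaugeField.gaugeAct w U) = descendTo F ℰp J K hlt.le U},
          ∑ ℓ : PBond (F.P K) 0,
          dist1 (U ℓ * ((GaugeField.gaugeAct (w : Site (F.P K) 0 → Matrix.specialUnitaryGroup (Fin 2) ℂ) (1 : GaugeField (F.P K) 0 (Matrix.specialUnitaryGroup (Fin 2) ℂ))) ℓ)⁻¹) ^ 2)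
          ≤ wilsonAction4 U - minActionRegPr F J K hlt.le ε₀ (1 : GaugeField (F.P J) 0 (Matrix.specialUnitaryGroup (Fin 2) ℂ)) := by
  obtain ⟨γ₁, hγ₁, hmain⟩ := exists_tubeGrowth_flat_of_isolated L b₀ p₀ hb hp
  refine ⟨min γ₁ 1, lt_min hγ₁ one_pos, ?_⟩
  intro F γ hFL hγ hγle J K hlt hk ε₀ hε₀ hr3 hr2 hε₀a hCL δ
  exact hmain F γ hFL hγ (hγle.trans (min_le_left _ _)) J K hlt.le hk ε₀ hε₀ hr3 hr2
    (one_mem_histGood_θBal F hγ (hγle.trans (min_le_right _ _)) hb p₀ K J) δ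
    (isol_of_orbBar F hlt.le 1 1 δ (orbBar_one_of_prop7At F h7 hB₃ hFL hlt hε₀ hε₀a hCL))

/-- ★★★★ **GAP♭(1,1) ⟸ {CL(1), `Prop7AtMostOneCriticalOrbitAt L a₀ B₃`}**, for `γ ≤ γ₁(δ)`: §1 with ISOL∘(δ)(1,1) discharged as in
`exists_tubeGrowth_flat_of_prop7At`.  Compare ✓px17 `gapFlatAt_one_of_pos_of_prop7At_of_closePair` (GAP♭(1,1) ⟸ POS∘(1) ∧ Prop 7 ∧ CL(1)): here POS∘(1) is no
longer a letter — it is HESS∘ at the flat datum (bricks 1–4) through ✓(T3) `posCollar_of_hessian_pos_of_clauses`.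
[cite: Balaban1985Variational, Prop. 7 and (142) p.299; Balaban1985UV3, (12)-(13) p.259, (18)-(22) p.260] -/
theorem exists_gapFlat_flat_of_prop7At {L : ℕ} {a₀ B₃ : ℝ} (h7 : Prop7AtMostOneCriticalOrbitAt L a₀ B₃) (hB₃ : 0 < B₃)
    (b₀ p₀ : ℝ) (hb : 0 < b₀) (hp : 0 < p₀) (δ : ℝ) (hδ : 0 < δ) :
    ∃ γ₁ : ℝ, 0 < γ₁ ∧ ∀ (F : T3Family) (γ : ℝ), F.L = L → 0 < γ → γ ≤ γ₁ →
      ∀ (J K : ℕ) (hlt : J < K) (hk : K - J ≤ (F.P K).m + (F.P K).K)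
        (ε₀ : ℝ), 0 < ε₀ → (143 * ((((3 + 4 : ℕ) : ℝ)) ^ 2 / 4) ^ 2) * (2 * ε₀) ≤ 1 / 3 →
          2 * (2 * ε₀) ≤ 2 * deltaSU (Fin 2) / (((3 + 4) * F.L : ℕ) : ℝ) ^ 2 → ε₀ ≤ a₀ →
        closure (fibre F ℰp J K hlt.le 1 ∩ histGood F ℰp (θBal F.L γ b₀ p₀) K J) ⊆ fibre F ℰp J K hlt.le 1 →
        ∃ μ : ℝ, 0 < μ ∧ ∀ U ∈ fibre F ℰp J K hlt.le (1 : GaugeField (F.P J) 0 (Matrix.specialUnitaryGroup (Fin 2) ℂ)), U ∈ histGood F ℰp (θBal F.L γ b₀ p₀) K J →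
        μ * ((F.L : ℝ)⁻¹) ^ (2 * (K - J)) *
        (⨅ w : {w : Site (F.P K) 0 → Matrix.specialUnitaryGroup (Fin 2) ℂ |
        ∀ U : GaugeField (F.P K) 0 (Matrix.specialUnitaryGroup (Fin 2) ℂ),
        descendTo F ℰp J K hlt.le (GaugeField.gaugeAct w U) = descendTo F ℰp J K hlt.le U},
        ∑ ℓ : PBond (F.P K) 0,
        dist1 (U ℓ * ((GaugeField.gaugeAct (w : Site (F.P K) 0 → Matrix.specialUnitaryGroup (Fin 2) ℂ) (1 : GaugeField (F.P K) 0 (Matrix.specialUnitaryGroup (Fin 2) ℂ))) ℓ)⁻¹) ^ 2)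
        ≤ wilsonAction4 U - minActionRegPr F J K hlt.le ε₀ (1 : GaugeField (F.P J) 0 (Matrix.specialUnitaryGroup (Fin 2) ℂ)) := by
  obtain ⟨γ₁, hγ₁, hmain⟩ := exists_gapFlat_flat_of_isolated L b₀ p₀ hb hp δ hδ
  refine ⟨γ₁, hγ₁, ?_⟩
  intro F γ hFL hγ hγle J K hlt hk ε₀ hε₀ hr3 hr2 hε₀a hCL
  exact hmain F γ hFL hγ hγle J K hlt.le hk ε₀ hε₀ hr3 hr2
    (isol_of_orbBar F hlt.le 1 1 δ (orbBar_one_of_prop7At F h7 hB₃ hFL hlt hε₀ hε₀a hCL))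

end Summit.QuantumFields.YangMills.Theorems.FluctuationComparisonRegPrIntLS2BetaFlatGapOfIsolated

end
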